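import Literature.AnabelianGeometry.EtaleTheta.Discharge.Sec2HasMuLOfSectionCover
import Literature.AnabelianGeometry.EtaleTheta.Discharge.Sec2BarDeltaBridgeLe
import Literature.AnabelianGeometry.EtaleTheta.Discharge.Sec2BarDeltaIndex
import Literature.AnabelianGeometry.EtaleTheta.ThetaCoversModelNumerology
import Literature.AnabelianGeometry.EtaleTheta.LDeltaThetaIndex
import Literature.AnabelianGeometry.EtaleTheta.RootsOfUnityInBaseField
import Mathlib.Topology.Algebra.Group.ClosedSubgroup
import HarnessLib

/-!
# [EtTh] Rmk. 2.6.1 over §1: at EVERY theta setting of [EtTh] origin with `[Δ_Θ : l·Δ_Θ] = l`, the typed hypothesis `HasMuL`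
# of a setting-born cover («`Π_C` acts trivially on `Δ̄_Θ`») is EQUIVALENT to «`Π^tp_X` acts trivially on `Δ_Θ/l·Δ_Θ`», and —
# given a cyclotome datum — to print's «`K ⊇ μ_l`» EXACTLY (proof-only)

S. Mochizuki, *The étale theta function and its Frobenioid-theoretic manifestations*, Publ. RIMS **45** (2009) [EtTh], §2:
Rmk. 2.6.1 p. 40 («Suppose, for simplicity, that `K` contains a primitive `l`-th root of unity»), Def. 2.1 p. 35 («`Δ̄_X`»,
«`Δ̄_Θ ≅ (ℤ/lℤ)(1)`»), §1 p. 12 («`(Ẑ(1) ≅) Δ_Θ`») [cite: MochizukiEtTh2009, Rmk 2.6.1 p.40]. Cell abc-iut, layer L2, seat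
abc-iut-L2-t10 (gen 7), successor row «HASMUL ⟺ hμ AT EVERY [EtTh]-ORIGIN SETTING». PROOF-ONLY (0 definitions).

WHY. abc-iut-L2-t2's typed Rmk. 2.6.1 / Cor. 2.9 carry print's «`μ_l ⊆ K`» as `T.HasMuL` — a statement inside the PROFINITE `Π_C`
(`[c, t] ∈ Ker(Δ_X ↠ Δ̄_X)` for `t` in the `Δ̄_Θ`-preimage). abc-iut-L2-d3 (`Sec2HasMuLOfSetting`) and this seat (`Sec2HasMuLOfSectionCover`,
p463007) derived it from the §1-level statement `hμ : ∀ σ a, a ∈ Δ_Θ → θ(σ)·a·θ(σ)⁻¹·a⁻¹ ∈ l·Δ_Θ` about `(Π^tp_X)^Θ` ALONE. This file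
proves the CONVERSE at every setting of [EtTh] origin whose `Δ_Θ` has the printed numerology `[Δ_Θ : l·Δ_Θ] = l` (e.g. from a
cyclotome datum `CyclotomeMod 1 l`, abc-iut-L2-t8's `index_lDeltaTheta_of_cyclotomeMod`), `l` odd:

* §1 `ThetaSetting.map_barThetaTp_sup_barKerHat` — `toHat(barThetaTp) · barKerHat = barThetaHat`: `toHat(barThetaTp)` is dense in the
  compact `barThetaHat` (abc-iut-L2-d3 gen 5's `barThetaHat_eq_closure_map_barThetaTp`) and `barKerHat` is closed of index `l` there (gen 4's
  `IsEtThOrigin.relIndex_barKerHat`), hence OPEN (Mathlib `Subgroup.isOpen_of_isClosed_of_finiteIndex`); so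
  `relIndex_barKerHat_map_barThetaTp : [toHat(barThetaTp)·barKerHat : barKerHat] = l`;
* §1 **`ThetaSetting.comap_barKerHat_inf_barThetaTp`** — THE BRIDGE `toHat⁻¹(barKerHat l) ∩ barThetaTp l = barKerTp l` (the reverse of
  abc-iut-L2-d3's `barKerTp_le_comap_barKerHat`), by the index count `[barThetaTp : K] = l = [barThetaTp : barKerTp]`
  (`relIndex_barKerTp_barThetaTp` + `hidx`) and `barKerTp ≤ K`; `toTheta_mem_lDeltaTheta_of_toHat_mem_barKerHat` (with
  abc-iut-L2-d3's `deltaTheta_inf_powTheta : Δ_Θ ∩ ⟨l-th powers⟩ = l·Δ_Θ`); `hμ_of_commutator_mem_barKerHat`;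
* §2 (any `MuTwoSetting`, any profinite completion `ιC`, `I := e.piCDataOf ιC hιC`) `CLevelData.hμ_of_commutator_mem_barKer_piCDataOf` and
  the `iff`s **`temperedCoverDataOfHuuOfSection_hasMuL_iff`**, `temperedCoverDataOfSection_hasMuL_iff`, `temperedCoverData_hasMuL_iff` —
  for all three setting-born constructors: **`T.HasMuL ↔ hμ`**; `hidx` discharged by a cyclotome datum in `…_of_cyclotomeMod`;
* §3 (any `ThetaSetting` with a cyclotome datum `μ : CyclotomeMod 1 l`) `ThetaSetting.hμ_iff_forall_galMuN_eq` (`hμ` ⟺ `Π^tp_X` fixes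
  `μ_l(ℚ̄_p)` through `aug`, by the equivariance `red_conj` and `Ker(Δ_Θ ↠ μ_l) = l·Δ_Θ`, abc-iut-L2-t8's `ker_redOne`),
  `forall_galMuN_aug_eq_iff_coe_muN_mem_K` (`aug(Π^tp_X) = G_K` + the infinite Galois correspondence for `ℚ̄_p/ℚ_p`), hence
  **`hμ_iff_coe_muN_mem_K : hμ ↔ ∀ ζ ∈ μ_l(ℚ̄_p), ζ ∈ K`** — the §1 statement IS print's «`K` contains a primitive `l`-th root of unity»;
  and the headline **`CLevelData.temperedCoverDataOfHuuOfSection_hasMuL_iff_coe_muN_mem_K`**: for THE R312 constructor at any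
  `MuTwoSetting` of [EtTh] origin with `μ : CyclotomeMod 1 l` (odd `l`), **`T.HasMuL ↔ μ_l(ℚ̄_p) ⊆ K`** — L2-t2's typed binder is EXACTLY
  print's hypothesis (with K12: discharged for `l ∣ p − 1 ∨ (p = 2 ∧ l = 2)` at every such setting, `…_hasMuL_of_dvd_pred_or`).

CENSUS CONSEQUENCE: L2-t2's binder is a statement about the §1 theta setting ALONE wherever `Δ_Θ/l·Δ_Θ ≅ ℤ/l`: at `κ′` `hμ` holds for
every `l` (K10 v2), at the χ-models `hμ ⟺ μ_l ⊆ ℚ_p` (p466422) — consistent with the direct χ′ computation p467907. HONEST LIMITS: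
`hidx` is print's «`Δ_Θ ≅ Ẑ(1)`» read mod `l`, an INPUT here (the root interface does not fix `Δ_Θ` up to isomorphism); nothing of
[EtTh] asserted; no side taken on [IUTchIII] Cor. 3.12; typed ≠ proved.
-/

noncomputable section

namespace Literature.AnabelianGeometry.EtaleTheta

open Literature.AnabelianGeometry.SemiGraphs ThetaCovers
open _root_.Topology

/-! ## §1. The bridge `toHat⁻¹(Ker(Δ_X ↠ Δ̄_X)) ∩ (Δ̄_Θ-preimage)^tp = Ker(Δ^tp_X ↠ Δ̄_X)` -/

namespace ThetaSetting

variable {p : ℕ} [Fact p.Prime] (D : ThetaSetting p) (l : ℕ)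

/-- **`toHat(barThetaTp) · barKerHat = barThetaHat`** for a setting of [EtTh] origin and odd `l`: the image of the tempered
`Δ̄_Θ`-preimage is dense in `barThetaHat`, in which `barKerHat` is a closed subgroup of finite index `l`, hence open; an open
subgroup containing a dense one is everything. [cite: MochizukiEtTh2009, Def 2.1 p.35] -/
theorem map_barThetaTp_sup_barKerHat (hO : D.IsEtThOrigin) (hodd : Odd l) :
    (D.barThetaTp l).map D.toHat.toMonoidHom ⊔ D.barKerHat l = D.barThetaHat l := by
  have hl0 : l ≠ 0 := by obtain ⟨k, hk⟩ := hodd; omega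
  set L := D.barThetaHat l with hL
  set M := (D.barThetaTp l).map D.toHat.toMonoidHom with hM
  have hML : M ≤ L := (Subgroup.le_topologicalClosure M).trans (D.barThetaHat_eq_closure_map_barThetaTp l).ge
  have hKL : D.barKerHat l ≤ L := D.barKerHat_le_barThetaHat l
  refine le_antisymm (sup_le hML hKL) ?_
  -- inside the topological group `↥L`
  let N : Subgroup L := (D.barKerHat l).subgroupOf L
  have hNidx : N.index = l := hO.relIndex_barKerHat l hodd
  haveI : N.FiniteIndex := ⟨by rw [hNidx]; exact hl0⟩
  have hNclosed : IsClosed (N : Set L) := by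
    rw [Subgroup.coe_subgroupOf]
    exact (D.isClosed_barKerHat l).preimage continuous_subtype_val
  have hNopen : IsOpen (N : Set L) := N.isOpen_of_isClosed_of_finiteIndex hNclosed
  let M' : Subgroup L := M.subgroupOf L
  have hUopen : IsOpen ((M' ⊔ N : Subgroup L) : Set L) := Subgroup.isOpen_mono le_sup_right hNopen
  have hUclosed : IsClosed ((M' ⊔ N : Subgroup L) : Set L) := Subgroup.isClosed_of_isOpen _ hUopen
  have hM'dense : Dense (M' : Set L) := by
    rw [Subgroup.coe_subgroupOf, _root_.Topology.IsInducing.subtypeVal.dense_iff]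
    intro x
    have hxM : (x : D.PiHat) ∈ closure (M : Set D.PiHat) := by
      rw [← Subgroup.topologicalClosure_coe, ← D.barThetaHat_eq_closure_map_barThetaTp l]
      exact x.2
    refine closure_mono (fun y hy => ?_) hxM
    exact ⟨⟨y, hML hy⟩, hy, rfl⟩
  have hUtop : (M' ⊔ N : Subgroup L) = ⊤ := by
    have hdense : Dense ((M' ⊔ N : Subgroup L) : Set L) :=
      hM'dense.mono (SetLike.coe_subset_coe.mpr le_sup_left)
    rw [← Subgroup.coe_eq_univ, ← hdense.closure_eq, hUclosed.closure_eq]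
  have h : (M ⊔ D.barKerHat l).subgroupOf L = ⊤ := by rw [Subgroup.subgroupOf_sup hML hKL]; exact hUtop
  exact Subgroup.subgroupOf_eq_top.mp h

/-- Hence **`[toHat(barThetaTp) : toHat(barThetaTp) ∩ barKerHat] = l`** (`barKerHat ⊴ Π_X`). [cite: MochizukiEtTh2009, Def 2.1 p.35] -/
theorem relIndex_barKerHat_map_barThetaTp (hO : D.IsEtThOrigin) (hodd : Odd l) :
    (D.barKerHat l).relIndex ((D.barThetaTp l).map D.toHat.toMonoidHom) = l := by
  haveI := D.barKerHat_normal l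
  rw [← Subgroup.relIndex_sup_right, D.map_barThetaTp_sup_barKerHat l hO hodd]
  exact hO.relIndex_barKerHat l hodd

/-- **THE BRIDGE**: for a setting of [EtTh] origin, odd `l`, and `[Δ_Θ : l·Δ_Θ] = l`, an element of the tempered `Δ̄_Θ`-preimage
whose profinite image lies in `Ker(Δ_X ↠ Δ̄_X)` already lies in the TEMPERED kernel: `toHat⁻¹(barKerHat l) ∩ barThetaTp l = barKerTp l`
(reverse of abc-iut-L2-d3's `barKerTp_le_comap_barKerHat`; index count `l = [barThetaTp : K]·… = [barThetaTp : barKerTp]`).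
[cite: MochizukiEtTh2009, Def 2.1 p.35] -/
theorem comap_barKerHat_inf_barThetaTp (hO : D.IsEtThOrigin) (hodd : Odd l)
    (hidx : (D.lDeltaTheta l).relIndex D.DeltaTheta = l) :
    (D.barKerHat l).comap D.toHat.toMonoidHom ⊓ D.barThetaTp l = D.barKerTp l := by
  have hl0 : 0 < l := by obtain ⟨k, hk⟩ := hodd; omega
  set K := (D.barKerHat l).comap D.toHat.toMonoidHom ⊓ D.barThetaTp l with hK
  have h1 : D.barKerTp l ≤ K := le_inf (D.barKerTp_le_comap_barKerHat l) (D.barKerTp_le_barThetaTp l)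
  have h2 : K ≤ D.barThetaTp l := inf_le_right
  have hKi : K.relIndex (D.barThetaTp l) = l := by
    rw [hK, Subgroup.inf_relIndex_right, Subgroup.relIndex_comap, D.relIndex_barKerHat_map_barThetaTp l hO hodd]
  have hTi : (D.barKerTp l).relIndex (D.barThetaTp l) = l := by rw [D.relIndex_barKerTp_barThetaTp l hO hodd, hidx]
  have hmul := Subgroup.relIndex_mul_relIndex (D.barKerTp l) K (D.barThetaTp l) h1 h2
  rw [hKi, hTi] at hmul
  have h3 : (D.barKerTp l).relIndex K = 1 := Nat.eq_of_mul_eq_mul_right hl0 (hmul.trans (one_mul l).symm)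
  exact le_antisymm (Subgroup.relIndex_eq_one.mp h3) h1

/-- **Elementwise**: for `w ∈ Π^tp_X` with `θ(w) ∈ Δ_Θ` and `toHat w ∈ Ker(Δ_X ↠ Δ̄_X)`, `θ(w) ∈ l·Δ_Θ` (the bridge, then abc-iut-L2-d3's
`Δ_Θ ∩ ⟨l-th powers⟩ = l·Δ_Θ`). [cite: MochizukiEtTh2009, Def 2.1 p.35] -/
theorem toTheta_mem_lDeltaTheta_of_toHat_mem_barKerHat (hO : D.IsEtThOrigin) (hodd : Odd l)
    (hidx : (D.lDeltaTheta l).relIndex D.DeltaTheta = l) {w : D.PiTemp} (hΔ : D.toTheta w ∈ D.DeltaTheta)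
    (hw : D.toHat w ∈ D.barKerHat l) : D.toTheta w ∈ D.lDeltaTheta l := by
  have hwΔ : w ∈ D.DeltaTemp := by
    rw [← D.comap_toHat_deltaHat]
    exact D.barKerHat_le_deltaHat l hw
  have hwT : w ∈ D.barThetaTp l := (D.mem_barThetaTp_iff l).mpr ⟨hwΔ, Subgroup.mem_sup_right hΔ⟩
  have hwK : w ∈ D.barKerTp l := by
    rw [← D.comap_barKerHat_inf_barThetaTp l hO hodd hidx]
    exact ⟨hw, hwT⟩
  exact (D.deltaTheta_inf_powTheta l hO hodd).le ⟨hΔ, ((D.mem_barKerTp_iff l).mp hwK).2⟩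

/-- **«`Π_X` acts trivially on `barThetaHat/barKerHat`» ⟹ «`Π^tp_X` acts trivially on `Δ_Θ/l·Δ_Θ`» (`hμ`)**: for `a = θ(x) ∈ Δ_Θ`,
`toHat x ∈ [Δ_X,Δ_X]⁻ ⊆ barThetaHat` (root clause `ker_toEll`), so `toHat [σ, x] ∈ barKerHat`, and the previous lemma applies to
`w := [σ, x]`. [cite: MochizukiEtTh2009, Rmk 2.6.1 p.40] -/
theorem hμ_of_commutator_mem_barKerHat (hO : D.IsEtThOrigin) (hodd : Odd l)
    (hidx : (D.lDeltaTheta l).relIndex D.DeltaTheta = l)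
    (h : ∀ (σ : D.PiTemp), ∀ t ∈ D.barThetaHat l, D.toHat σ * t * (D.toHat σ)⁻¹ * t⁻¹ ∈ D.barKerHat l) :
    ∀ (σ : D.PiTemp) (a : D.GtpTheta), a ∈ D.DeltaTheta →
      D.toTheta σ * a * (D.toTheta σ)⁻¹ * a⁻¹ ∈ D.lDeltaTheta l := by
  intro σ a ha
  obtain ⟨x, rfl⟩ := D.toTheta_surjective a
  have hx : D.toHat x ∈ D.barThetaHat l := by
    have hker : x ∈ (D.thetaToEll.comp D.toTheta).ker := ha
    rw [D.ker_toEll] at hker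
    exact (Subgroup.topologicalClosure_mono le_sup_left) hker
  have hcomm := h σ _ hx
  rw [← map_inv, ← map_inv, ← map_mul, ← map_mul, ← map_mul] at hcomm
  have hΔ : D.toTheta (σ * x * σ⁻¹ * x⁻¹) ∈ D.DeltaTheta := by
    rw [map_mul, map_mul, map_mul, map_inv, map_inv]
    haveI : D.DeltaTheta.Normal := inferInstanceAs D.thetaToEll.ker.Normal
    exact mul_mem (Subgroup.Normal.conj_mem inferInstance _ ha _) (inv_mem ha)
  have := D.toTheta_mem_lDeltaTheta_of_toHat_mem_barKerHat l hO hodd hidx hΔ hcomm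
  rwa [map_mul, map_mul, map_mul, map_inv, map_inv] at this

/-- The numerology input from a cyclotome datum: `Δ_Θ/l·Δ_Θ ≅ μ_l` gives `[Δ_Θ : l·Δ_Θ] = l` (abc-iut-L2-t8).
[cite: MochizukiEtTh2009, Def 2.13 p.46] -/
theorem relIndex_lDeltaTheta_of_cyclotomeMod {l : ℕ+} (μ : D.CyclotomeMod 1 l) :
    (D.lDeltaTheta l).relIndex D.DeltaTheta = l :=
  D.index_lDeltaTheta_of_cyclotomeMod μ

end ThetaSetting

/-! ## §2. `HasMuL ↔ hμ` for the setting-born covers -/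

namespace MuTwoSetting.CLevelData

variable {p : ℕ} [Fact p.Prime] {M : MuTwoSetting p}
variable {PC : Type} [Group PC] [TopologicalSpace PC] [IsTopologicalGroup PC] [T2Space PC]

/-- **`Π_C` acting trivially on `Δ̄_Θ` forces `hμ`** (`I := e.piCDataOf ιC hιC`, any profinite completion `ιC`): restrict to
`c := incl(toHat σ)`, `t := incl(t̂)` with `t̂ ∈ barThetaHat` (`barTheta = incl(barThetaHat)`, `barKer = incl(barKerHat)`, `incl` injective),
then §1. [cite: MochizukiEtTh2009, Rmk 2.6.1 p.40] -/
theorem hμ_of_commutator_mem_barKer_piCDataOf (e : M.CLevelData) (ιC : M.GtpC →ₜ* PC) (hιC : IsProfiniteCompletion ιC)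
    (op : M.toThetaSetting.OncePuncturedData) {l : ℕ} (hodd : Odd l) (hidx : (M.lDeltaTheta l).relIndex M.DeltaTheta = l)
    (h : ∀ c : PC, ∀ t ∈ (e.piCDataOf ιC hιC).barTheta l, c * t * c⁻¹ * t⁻¹ ∈ (e.piCDataOf ιC hιC).barKer l) :
    ∀ (σ : M.PiTemp) (a : M.GtpTheta), a ∈ M.DeltaTheta →
      M.toTheta σ * a * (M.toTheta σ)⁻¹ * a⁻¹ ∈ M.lDeltaTheta l := by
  set I := e.piCDataOf ιC hιC with hI
  refine M.toThetaSetting.hμ_of_commutator_mem_barKerHat l op.origin hodd hidx fun σ t ht => ?_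
  have ht' : I.incl t ∈ I.barTheta l := by
    rw [I.barTheta_eq_map l op]
    exact ⟨t, ht, rfl⟩
  have hc := h (I.incl (M.toHat σ)) (I.incl t) ht'
  have hc' : I.incl (M.toHat σ * t * (M.toHat σ)⁻¹ * t⁻¹) ∈ I.barKer l := by simpa only [map_mul, map_inv] using hc
  rw [I.barKer_eq_map l op] at hc'
  obtain ⟨y, hy, hyEq⟩ := hc'
  rwa [← I.incl_injective hyEq]

/-- **`HasMuL ↔ hμ` for abc-iut-L2-d3's R312 constructor of record `temperedCoverDataOfHuuOfSection`** (SECTION cusp datum), at any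
`MuTwoSetting` whose setting has `[Δ_Θ : l·Δ_Θ] = l` (`←` is p463007). [cite: MochizukiEtTh2009, Rmk 2.6.1 p.40] -/
theorem temperedCoverDataOfHuuOfSection_hasMuL_iff (e : M.CLevelData) (ιC : M.GtpC →ₜ* PC) (hιC : IsProfiniteCompletion ιC)
    (hinj : Function.Injective ιC) (op : M.toThetaSetting.OncePuncturedData) {l : ℕ} (hodd : Odd l)
    (s : ↥M.GK →* M.PiTemp) (hsa : ∀ σ, M.aug (s σ) = (σ : GQp p)) (hsZ : ∀ σ, M.toZ (s σ) = 1)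
    (hιell : ∀ c ∈ (e.piCDataOf ιC hιC).augGK.ker, c ∉ (e.piCDataOf ιC hιC).PiX →
      ∀ d ∈ (e.piCDataOf ιC hιC).PiX ⊓ (e.piCDataOf ιC hιC).augGK.ker,
        c * d * c⁻¹ * d ∈ (e.piCDataOf ιC hιC).barTheta l)
    (hN : ((M.GtpXu l).map M.inclX).Normal) (hY : (M.GtpY.map M.inclX).Normal)
    {E : M.toThetaSetting.EtaleThetaData} (C : E.DoubleUnderline l) (hK : M.barKerTp l ≤ C.Huu)
    (hsH : ∀ σ, s σ ∈ C.Huu) {g : M.GtpC} (hgX : g ∉ M.inclX.range) (hι : C.IotaStable (e.conjX g))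
    (hidx : (M.lDeltaTheta l).relIndex M.DeltaTheta = l) :
    (e.temperedCoverDataOfHuuOfSection ιC hιC hinj op hodd s hsa hsZ hιell hN hY C hK hsH hgX hι).HasMuL ↔
      ∀ (σ : M.PiTemp) (a : M.GtpTheta), a ∈ M.DeltaTheta →
        M.toTheta σ * a * (M.toTheta σ)⁻¹ * a⁻¹ ∈ M.lDeltaTheta l :=
  ⟨fun h => e.hμ_of_commutator_mem_barKer_piCDataOf ιC hιC op hodd hidx h,
    fun hμ => e.temperedCoverDataOfHuuOfSection_hasMuL ιC hιC hinj op hodd s hsa hsZ hιell hN hY C hK hsH hgX hι hμ⟩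

/-- **`HasMuL ↔ hμ` for this seat's `temperedCoverDataOfSection`** (un-pinned section-route assembly, p450512).
[cite: MochizukiEtTh2009, Rmk 2.6.1 p.40] -/
theorem temperedCoverDataOfSection_hasMuL_iff (e : M.CLevelData) (ιC : M.GtpC →ₜ* PC) (hιC : IsProfiniteCompletion ιC)
    (hinj : Function.Injective ιC) (op : M.toThetaSetting.OncePuncturedData) {l : ℕ} (hodd : Odd l)
    (s : ↥M.GK →* M.PiTemp) (hsa : ∀ σ, M.aug (s σ) = (σ : GQp p)) (hsZ : ∀ σ, M.toZ (s σ) = 1) (hsc : Continuous s)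
    (hιell : ∀ c ∈ (e.piCDataOf ιC hιC).augGK.ker, c ∉ (e.piCDataOf ιC hιC).PiX →
      ∀ d ∈ (e.piCDataOf ιC hιC).PiX ⊓ (e.piCDataOf ιC hιC).augGK.ker,
        c * d * c⁻¹ * d ∈ (e.piCDataOf ιC hιC).barTheta l)
    (hN : ((M.GtpXu l).map M.inclX).Normal) (hY : (M.GtpY.map M.inclX).Normal)
    (hidx : (M.lDeltaTheta l).relIndex M.DeltaTheta = l) :
    (e.temperedCoverDataOfSection ιC hιC hinj op hodd s hsa hsZ hsc hιell hN hY).HasMuL ↔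
      ∀ (σ : M.PiTemp) (a : M.GtpTheta), a ∈ M.DeltaTheta →
        M.toTheta σ * a * (M.toTheta σ)⁻¹ * a⁻¹ ∈ M.lDeltaTheta l :=
  ⟨fun h => e.hμ_of_commutator_mem_barKer_piCDataOf ιC hιC op hodd hidx h,
    fun hμ => e.temperedCoverDataOfSection_hasMuL ιC hιC hinj op hodd s hsa hsZ hsc hιell hN hY hμ⟩

/-- **`HasMuL ↔ hμ` for abc-iut-L2-d3's GEOMETRIC-cusp constructor `temperedCoverData`** (`←` is abc-iut-L2-d3's
`temperedCoverData_hasMuL`, `Sec2HasMuLOfSetting`). [cite: MochizukiEtTh2009, Rmk 2.6.1 p.40] -/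
theorem temperedCoverData_hasMuL_iff (e : M.CLevelData) (ιC : M.GtpC →ₜ* PC)
    (hιC : IsProfiniteCompletion ιC) (hinj : Function.Injective ιC) (op : M.toThetaSetting.OncePuncturedData)
    {l : ℕ} (hodd : Odd l) {x : M.Pt} (hx : M.IsCusp x)
    (hIx : ((e.piCDataOf ιC hιC).Dx x ⊓ (e.piCDataOf ιC hιC).augGK.ker) ⊔ (e.piCDataOf ιC hιC).barKer l =
      (e.piCDataOf ιC hιC).barTheta l)
    (hιell : ∀ c ∈ (e.piCDataOf ιC hιC).augGK.ker, c ∉ (e.piCDataOf ιC hιC).PiX →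
      ∀ d ∈ (e.piCDataOf ιC hιC).PiX ⊓ (e.piCDataOf ιC hιC).augGK.ker,
        c * d * c⁻¹ * d ∈ (e.piCDataOf ιC hιC).barTheta l)
    (hN : ((M.GtpXu l).map M.inclX).Normal) (hY : (M.GtpY.map M.inclX).Normal) {S : Subgroup PC}
    (hS : ((e.piCDataOf ιC hιC).coverDataAx l op hx hodd hIx hιell
        ((e.piCDataOf ιC hιC).inv_theta_of_inv_ell l op hιell)).toCoverData.IsSplitting S)
    (hSc : IsClosed (S : Set PC)) (hidx : (M.lDeltaTheta l).relIndex M.DeltaTheta = l) :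
    (e.temperedCoverData ιC hιC hinj op hodd hx hIx hιell hN hY hS hSc).HasMuL ↔
      ∀ (σ : M.PiTemp) (a : M.GtpTheta), a ∈ M.DeltaTheta →
        M.toTheta σ * a * (M.toTheta σ)⁻¹ * a⁻¹ ∈ M.lDeltaTheta l :=
  ⟨fun h => e.hμ_of_commutator_mem_barKer_piCDataOf ιC hιC op hodd hidx h,
    fun hμ => e.temperedCoverData_hasMuL ιC hιC hinj op hodd hx hIx hιell hN hY hS hSc hμ⟩

/-- **The same `iff` for the R312 constructor with the numerology input DISCHARGED by a cyclotome datum** `μ : CyclotomeMod 1 l`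
(`l : ℕ+` odd). [cite: MochizukiEtTh2009, Rmk 2.6.1 p.40] -/
theorem temperedCoverDataOfHuuOfSection_hasMuL_iff_of_cyclotomeMod (e : M.CLevelData) (ιC : M.GtpC →ₜ* PC)
    (hιC : IsProfiniteCompletion ιC) (hinj : Function.Injective ιC) (op : M.toThetaSetting.OncePuncturedData) {l : ℕ+}
    (hodd : Odd (l : ℕ)) (s : ↥M.GK →* M.PiTemp) (hsa : ∀ σ, M.aug (s σ) = (σ : GQp p)) (hsZ : ∀ σ, M.toZ (s σ) = 1)
    (hιell : ∀ c ∈ (e.piCDataOf ιC hιC).augGK.ker, c ∉ (e.piCDataOf ιC hιC).PiX →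
      ∀ d ∈ (e.piCDataOf ιC hιC).PiX ⊓ (e.piCDataOf ιC hιC).augGK.ker,
        c * d * c⁻¹ * d ∈ (e.piCDataOf ιC hιC).barTheta l)
    (hN : ((M.GtpXu l).map M.inclX).Normal) (hY : (M.GtpY.map M.inclX).Normal)
    {E : M.toThetaSetting.EtaleThetaData} (C : E.DoubleUnderline l) (hK : M.barKerTp l ≤ C.Huu)
    (hsH : ∀ σ, s σ ∈ C.Huu) {g : M.GtpC} (hgX : g ∉ M.inclX.range) (hι : C.IotaStable (e.conjX g))
    (μ : M.toThetaSetting.CyclotomeMod 1 l) :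
    (e.temperedCoverDataOfHuuOfSection ιC hιC hinj op hodd s hsa hsZ hιell hN hY C hK hsH hgX hι).HasMuL ↔
      ∀ (σ : M.PiTemp) (a : M.GtpTheta), a ∈ M.DeltaTheta →
        M.toTheta σ * a * (M.toTheta σ)⁻¹ * a⁻¹ ∈ M.lDeltaTheta l :=
  e.temperedCoverDataOfHuuOfSection_hasMuL_iff ιC hιC hinj op hodd s hsa hsZ hιell hN hY C hK hsH hgX hι
    (M.toThetaSetting.relIndex_lDeltaTheta_of_cyclotomeMod μ)

end MuTwoSetting.CLevelData

/-! ## §3. With a cyclotome datum: `hμ` ⟺ `G_K` fixes `μ_l` ⟺ `μ_l ⊆ K` — print's hypothesis EXACTLY -/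

namespace ThetaSetting

variable {p : ℕ} [Fact p.Prime] {D : ThetaSetting p}

/-- Equivariance of the cyclotome reduction read on `Δ_Θ` (`redOne`): `red(θ(σ)·x·θ(σ)⁻¹) = σ·red(x)` (the field `red_conj`).
[cite: MochizukiEtTh2009, Def 2.13 p.46] -/
theorem redOne_conj {l : ℕ+} (μ : D.CyclotomeMod 1 l) (σ : D.PiTemp) (x : D.DeltaTheta) :
    redOne μ ⟨D.toTheta σ * x * (D.toTheta σ)⁻¹,
        (inferInstanceAs D.thetaToEll.ker.Normal : D.DeltaTheta.Normal).conj_mem _ x.2 _⟩ =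
      galMuN p l (D.aug.toMonoidHom σ) (redOne μ x) := by
  rw [redOne_apply, redOne_apply]
  exact μ.red_conj σ ⟨(x : D.GtpTheta), D.lDeltaTheta_one.symm ▸ x.2⟩

/-- **`hμ` ⟺ «`Π^tp_X` fixes `μ_l(ℚ̄_p)` through `aug`»**, given a cyclotome datum `μ : CyclotomeMod 1 l` (`Δ_Θ/l·Δ_Θ ≅ μ_l`
equivariantly: abc-iut-L2-t8's `ker_redOne` + `red_conj`). [cite: MochizukiEtTh2009, Rmk 2.6.1 p.40] -/
theorem hμ_iff_forall_galMuN_eq {l : ℕ+} (μ : D.CyclotomeMod 1 l) :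
    (∀ (σ : D.PiTemp) (a : D.GtpTheta), a ∈ D.DeltaTheta →
        D.toTheta σ * a * (D.toTheta σ)⁻¹ * a⁻¹ ∈ D.lDeltaTheta l) ↔
      ∀ (σ : D.PiTemp) (m : MuN p l), galMuN p l (D.aug.toMonoidHom σ) m = m := by
  haveI hN : D.DeltaTheta.Normal := inferInstanceAs D.thetaToEll.ker.Normal
  constructor
  · intro h σ m
    obtain ⟨x, rfl⟩ := redOne_surjective μ m
    rw [← redOne_conj μ σ x, ← mul_inv_eq_one]
    have key : (⟨D.toTheta σ * x * (D.toTheta σ)⁻¹, hN.conj_mem _ x.2 _⟩ * x⁻¹ : D.DeltaTheta) ∈ (redOne μ).ker := by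
      rw [ker_redOne, Subgroup.mem_subgroupOf]
      exact h σ x x.2
    rw [MonoidHom.mem_ker, map_mul, map_inv] at key
    exact key
  · intro h σ a ha
    set x : D.DeltaTheta := ⟨a, ha⟩ with hx
    have key : redOne μ (⟨D.toTheta σ * x * (D.toTheta σ)⁻¹, hN.conj_mem _ x.2 _⟩ * x⁻¹) = 1 := by
      rw [map_mul, map_inv, redOne_conj μ σ x, h, mul_inv_cancel]
    rw [← MonoidHom.mem_ker, ker_redOne, Subgroup.mem_subgroupOf] at key
    exact key

/-- **«`Π^tp_X` fixes `μ_N(ℚ̄_p)` through `aug`» ⟺ «`μ_N(ℚ̄_p) ⊆ K`»** (`aug(Π^tp_X) = G_K`, root clause `range_aug`, and the Galois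
correspondence `ℚ̄_p^{G_K} = K` for the infinite Galois extension `ℚ̄_p/ℚ_p`). [cite: MochizukiEtTh2009, Rmk 2.6.1 p.40] -/
theorem forall_galMuN_aug_eq_iff_coe_muN_mem_K (N : ℕ+) :
    (∀ (σ : D.PiTemp) (m : MuN p N), galMuN p N (D.aug.toMonoidHom σ) m = m) ↔
      ∀ ζ : MuN p N, ((ζ : (PadicAlgCl p)ˣ) : PadicAlgCl p) ∈ D.K := by
  haveI : IsGalois ℚ_[p] (PadicAlgCl p) := {}
  constructor
  · intro h ζ
    have hmem : ((ζ : (PadicAlgCl p)ˣ) : PadicAlgCl p) ∈ IntermediateField.fixedField D.K.fixingSubgroup := by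
      rw [IntermediateField.mem_fixedField_iff]
      intro τ hτ
      have hτ' : τ ∈ D.aug.toMonoidHom.range := by rw [D.range_aug]; exact hτ
      obtain ⟨σ, rfl⟩ := hτ'
      have hσ := congrArg (fun u : MuN p N => ((u : (PadicAlgCl p)ˣ) : PadicAlgCl p)) (h σ ζ)
      simpa only [galMuN_apply_coe] using hσ
    rwa [InfiniteGalois.fixedField_fixingSubgroup] at hmem
  · intro h σ m
    apply Subtype.ext
    apply Units.ext
    rw [galMuN_apply_coe]
    have hσ : D.aug.toMonoidHom σ ∈ D.K.fixingSubgroup := by rw [← D.range_aug]; exact ⟨σ, rfl⟩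
    exact (IntermediateField.mem_fixingSubgroup_iff _ _).mp hσ _ (h m)

/-- **`hμ` IS print's hypothesis**: given a cyclotome datum `μ : CyclotomeMod 1 l`, «`Π^tp_X` acts trivially on `Δ_Θ/l·Δ_Θ`» ⟺
«`K` contains the `l`-th roots of unity of `ℚ̄_p`» (Rmk. 2.6.1: «Suppose … that `K` contains a primitive `l`-th root of unity»).
[cite: MochizukiEtTh2009, Rmk 2.6.1 p.40] -/
theorem hμ_iff_coe_muN_mem_K {l : ℕ+} (μ : D.CyclotomeMod 1 l) :
    (∀ (σ : D.PiTemp) (a : D.GtpTheta), a ∈ D.DeltaTheta →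
        D.toTheta σ * a * (D.toTheta σ)⁻¹ * a⁻¹ ∈ D.lDeltaTheta l) ↔
      ∀ ζ : MuN p l, ((ζ : (PadicAlgCl p)ˣ) : PadicAlgCl p) ∈ D.K :=
  (hμ_iff_forall_galMuN_eq μ).trans (forall_galMuN_aug_eq_iff_coe_muN_mem_K l)

/-- Hence **`hμ` holds at EVERY setting with a cyclotome datum when `l ∣ p − 1 ∨ (p = 2 ∧ l = 2)`** (K12: `μ_l(ℚ̄_p) ⊆ ℚ_p ⊆ K`).
[cite: Serre1973, Ch. II §3.1 Prop. 7] -/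
theorem hμ_of_cyclotomeMod_of_dvd_pred_or {l : ℕ+} (μ : D.CyclotomeMod 1 l)
    (hl : (l : ℕ) ∣ p - 1 ∨ (p = 2 ∧ (l : ℕ) = 2)) :
    ∀ (σ : D.PiTemp) (a : D.GtpTheta), a ∈ D.DeltaTheta →
      D.toTheta σ * a * (D.toTheta σ)⁻¹ * a⁻¹ ∈ D.lDeltaTheta l :=
  (hμ_iff_coe_muN_mem_K μ).mpr (D.coe_muN_mem_K_of_dvd_pred_or p l hl)

end ThetaSetting

namespace MuTwoSetting.CLevelData

variable {p : ℕ} [Fact p.Prime] {M : MuTwoSetting p}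
variable {PC : Type} [Group PC] [TopologicalSpace PC] [IsTopologicalGroup PC] [T2Space PC]

/-- **HEADLINE — L2-t2's `HasMuL` IS print's «`K ⊇ μ_l`».** For abc-iut-L2-d3's R312 constructor of record at ANY `MuTwoSetting` of
[EtTh] origin (`op`) carrying a cyclotome datum `μ : CyclotomeMod 1 l` (odd `l`): `T.HasMuL ↔ ∀ ζ ∈ μ_l(ℚ̄_p), ζ ∈ K`
(§2 `…_hasMuL_iff_of_cyclotomeMod` + §3 `hμ_iff_coe_muN_mem_K`). [cite: MochizukiEtTh2009, Rmk 2.6.1 p.40] -/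
theorem temperedCoverDataOfHuuOfSection_hasMuL_iff_coe_muN_mem_K (e : M.CLevelData) (ιC : M.GtpC →ₜ* PC)
    (hιC : IsProfiniteCompletion ιC) (hinj : Function.Injective ιC) (op : M.toThetaSetting.OncePuncturedData) {l : ℕ+}
    (hodd : Odd (l : ℕ)) (s : ↥M.GK →* M.PiTemp) (hsa : ∀ σ, M.aug (s σ) = (σ : GQp p)) (hsZ : ∀ σ, M.toZ (s σ) = 1)
    (hιell : ∀ c ∈ (e.piCDataOf ιC hιC).augGK.ker, c ∉ (e.piCDataOf ιC hιC).PiX →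
      ∀ d ∈ (e.piCDataOf ιC hιC).PiX ⊓ (e.piCDataOf ιC hιC).augGK.ker,
        c * d * c⁻¹ * d ∈ (e.piCDataOf ιC hιC).barTheta l)
    (hN : ((M.GtpXu l).map M.inclX).Normal) (hY : (M.GtpY.map M.inclX).Normal)
    {E : M.toThetaSetting.EtaleThetaData} (C : E.DoubleUnderline l) (hK : M.barKerTp l ≤ C.Huu)
    (hsH : ∀ σ, s σ ∈ C.Huu) {g : M.GtpC} (hgX : g ∉ M.inclX.range) (hι : C.IotaStable (e.conjX g))
    (μ : M.toThetaSetting.CyclotomeMod 1 l) :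
    (e.temperedCoverDataOfHuuOfSection ιC hιC hinj op hodd s hsa hsZ hιell hN hY C hK hsH hgX hι).HasMuL ↔
      ∀ ζ : MuN p l, ((ζ : (PadicAlgCl p)ˣ) : PadicAlgCl p) ∈ M.K :=
  (e.temperedCoverDataOfHuuOfSection_hasMuL_iff_of_cyclotomeMod ιC hιC hinj op hodd s hsa hsZ hιell hN hY C hK hsH hgX hι
    μ).trans (M.toThetaSetting.hμ_iff_coe_muN_mem_K μ)

/-- **… so `HasMuL` is DISCHARGED for THE R312 constructor at every such setting when `l ∣ p − 1 ∨ (p = 2 ∧ l = 2)`** (K12).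
[cite: MochizukiEtTh2009, Rmk 2.6.1 p.40] -/
theorem temperedCoverDataOfHuuOfSection_hasMuL_of_dvd_pred_or (e : M.CLevelData) (ιC : M.GtpC →ₜ* PC)
    (hιC : IsProfiniteCompletion ιC) (hinj : Function.Injective ιC) (op : M.toThetaSetting.OncePuncturedData) {l : ℕ+}
    (hodd : Odd (l : ℕ)) (s : ↥M.GK →* M.PiTemp) (hsa : ∀ σ, M.aug (s σ) = (σ : GQp p)) (hsZ : ∀ σ, M.toZ (s σ) = 1)
    (hιell : ∀ c ∈ (e.piCDataOf ιC hιC).augGK.ker, c ∉ (e.piCDataOf ιC hιC).PiX →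
      ∀ d ∈ (e.piCDataOf ιC hιC).PiX ⊓ (e.piCDataOf ιC hιC).augGK.ker,
        c * d * c⁻¹ * d ∈ (e.piCDataOf ιC hιC).barTheta l)
    (hN : ((M.GtpXu l).map M.inclX).Normal) (hY : (M.GtpY.map M.inclX).Normal)
    {E : M.toThetaSetting.EtaleThetaData} (C : E.DoubleUnderline l) (hK : M.barKerTp l ≤ C.Huu)
    (hsH : ∀ σ, s σ ∈ C.Huu) {g : M.GtpC} (hgX : g ∉ M.inclX.range) (hι : C.IotaStable (e.conjX g))
    (μ : M.toThetaSetting.CyclotomeMod 1 l) (hl : (l : ℕ) ∣ p - 1 ∨ (p = 2 ∧ (l : ℕ) = 2)) :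
    (e.temperedCoverDataOfHuuOfSection ιC hιC hinj op hodd s hsa hsZ hιell hN hY C hK hsH hgX hι).HasMuL :=
  e.temperedCoverDataOfHuuOfSection_hasMuL ιC hιC hinj op hodd s hsa hsZ hιell hN hY C hK hsH hgX hι
    (M.toThetaSetting.hμ_of_cyclotomeMod_of_dvd_pred_or μ hl)

end MuTwoSetting.CLevelData

end Literature.AnabelianGeometry.EtaleTheta

end
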